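import Literature.Analysis.FluidPDE.FluidComputer.ThresholdLevelTableU
import HarnessLib

/-!
# Kernel run of the re-cut table over the 10⁻² box, chunks 32 … 35 (bp3 gen 13, layer 4: robustness variant U)

HONEST FRAMING: low prior, high value-of-information experiment on Tao's machine paradigm; NOT a
claim that NS blows up.

Four kernel evaluations (`decide +kernel`; no `native_decide`, no extra axioms) of the checker
`runSteps` (`ThresholdLevelCheck.lean`) with the interval gate data `GIu` (all seven data within
relative `10⁻²`) on ≤ 25 steps of `ThresholdLevelTableU.stepsU` at a time, from `Bu i` towards the next chunk's
first level, returning `Bu (i+1)` (`Bu 0 = ThresholdLevelTable.Bc0`).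
-/

namespace Literature.Analysis.FluidPDE.FluidComputer

namespace ThresholdLevelTableU

open ThresholdLevelTable (Bc0 RbIt)

set_option maxHeartbeats 10000000 in
set_option maxRecDepth 200000 in
/-- Chunk 32 of the re-cut table run over the 10⁻² box (steps 800 … 824). [folklore] -/
theorem runU32 : runSteps 60 12 3 GIu RbIt Bu32 chunkU32 8323290466919780 = some Bu33 := by
  decide +kernel

set_option maxHeartbeats 10000000 in
set_option maxRecDepth 200000 in
/-- Chunk 33 of the re-cut table run over the 10⁻² box (steps 825 … 849). [folklore] -/
theorem runU33 : runSteps 60 12 3 GIu RbIt Bu33 chunkU33 9080207597954848 = some Bu34 := by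
  decide +kernel

set_option maxHeartbeats 10000000 in
set_option maxRecDepth 200000 in
/-- Chunk 34 of the re-cut table run over the 10⁻² box (steps 850 … 874). [folklore] -/
theorem runU34 : runSteps 60 12 3 GIu RbIt Bu34 chunkU34 9906078599780361 = some Bu35 := by
  decide +kernel

set_option maxHeartbeats 10000000 in
set_option maxRecDepth 200000 in
/-- Chunk 35 of the re-cut table run over the 10⁻² box (steps 875 … 899). [folklore] -/
theorem runU35 : runSteps 60 12 3 GIu RbIt Bu35 chunkU35 10806933931377166 = some Bu36 := by
  decide +kernel

end ThresholdLevelTableU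

end Literature.Analysis.FluidPDE.FluidComputer
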